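import Summits.QuantumFields.YangMills.Theorems.BalabanUVNodesN15TwoGridMeanZeroMultiplierL2
import Summits.QuantumFields.YangMills.Theorems.BalabanUVNodesN15TwoGridL2Stack
import Summits.QuantumFields.YangMills.Theorems.BalabanUVNodesN15TwoGridDressedJetNoFitC
import Summits.QuantumFields.YangMills.Theorems.BalabanUVNodesN15TwoGridEntry1
import HarnessLib

/-!
# N15 (NE2) — PROGRAMME K, part K-G: ★★★ THE η-DEFECT OF THE WHOLE FIRST-ORDER DRESSED JET OF BAŁABAN's FULL LANDAU-GAUGE PAIR `(Δ′_a⁻¹, Δ_a⁻¹)` — VALUE AND GRADIENT COMPONENTS —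
# IN (sup → L²-BLOCK) CURRENCY, HYPOTHESIS-FREE, NO LETTER ON `∇c′`, NO FIT OF `c′`, NO LEVEL DECOMPOSITION: III-B run through g0's generic jet device with the TARGET norm := part 61's
# L²-block norm on n15-b's stacked fine carrier

WHO ∕ WHEN.  Cell `pub-ymgap`, seat `pub-ymgap-dag-n15-a` (KNIT-BY-NAME seat of Track-A DAG node N15 = NE2, g25); `--kind proof --supports stmt-QuantumFields-27366 --as helper` (K3⁸;
count-neutral).  THEOREMS ONLY (0 `def`).  Over K-E `…TwoGridMeanZeroMultiplierL2` (★★★ `hasMajL2_gGrad_comp_idef_mulOp_blockAvg`, ★★ `hasMaj_comp_idef_mulOp_blockAvg_of_divAdj_l2`), K-F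
`…TwoGridL2Stack` (`hasMaj_stack_l2`, `hasMaj_projO_comp_l2`, `hasMaj_unstack_l2`, `exists_const_hasMaj_l2`, `hasMajL2_gOp_pair`), III-B `…TwoGridDressedJetNoFitC` (`stack_comp`, `idef_unstack_eq`),
g0 `BackgroundStep.idef_background_propagator_majorant_flat` (GENERIC in `b₁`, `b₂′`), n15-b B1∕B1b (`bgPropV_fix`, `isUnit_stepV`, `hasMaj_bgPropV`, `hasMaj_V_bgPropV`, `hasMaj_stack`, `hasMaj_unstack`,
`hasMaj_projO_comp`, `abs_blockAvg_le`, `idef_stack`, `bgPair`), `T4EtaRateCoeffDefect.hasMaj_idef_mulOp`, II-B (`diagK_const_mono`), M-C ★★★ (sup edition, front `G′`), parts 42∕52∕59∕61∕62∕68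
(`ineq110_114_pair` + `hasMaj_gOp∕grad∕gDivAdj_of_ineq`, `hasMaj_twoGridDefect`, `hasMaj_twoGridDefect_grad`, `HasMaj.to_l2Blocks`, `hasMajL2_entries114_pair`, `etaPow_mul_card_fineBond`),
`B11SectG.hasMaj_comp(_exp)`, `B9SectDWeightedNeumann.wrow_of_exp` BY NAME; nothing in the tree is modified.

WHY.  III-B's ninth row (the `c′`-defect under the fronts `∇′_νG′`) exists for the pair of record only in (sup → L²-block) currency (K-E: the mixed row «∇G∇*» is log-divergent in sup-block
currency but is Bałaban's printed (1.114) entry in L²-block currency).  g0's jet device is generic in the target block norm, so the WHOLE of III-B runs with the target norm := the L²-block norm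
on the stacked fine carrier `X′ × Option J`: the fine Neumann operator `K′ = (G′, ∇′G′)∘V̂′` is L²-block → L²-block by (1.114) clauses 0∕1 (K-F) and K-F's stacked calculus; the sources are the
bare defects (parts 52∕59, sup ⇒ L² free), the sandwiched `c′`-rows (M-C under `G′` — sup, weakened to L²; K-E under `∇′G′` — L² only) and the diagonal fit rows of `a′`.

WHAT.  §11 (torus carriers, generic pieces `G, G′` with rows as hypotheses) `hasMaj_comp_diagK_const_l2`, ★★ `hasMajL2_idef_bgPair_of_rows` — the hypothesis-free corollary for the pair
of record (`hasMajL2_idef_bgPair_gOp`, components incl. THE DRESSED GRADIENT ENTRY) is the sequel K-H `…TwoGridDressedJetL2FullG` (kept apart for the 400-line budget).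
HONEST FRAMING ∕ LIMITS.  The OUTPUT is measured in the L²-BLOCK norm — NOT the sup entry [B9] (3.42) prints; the sup upgrade (parts 70∕71's interpolation with the (1.111) oscillation rows;
rate loss) and the II-E-pattern packaging for the pair of record remain LOCATED.  `U ≡ 1` Landau-gauge pair on the torus family of record (b05 model of [B5] (1.69)–(1.71)); abelianised
scalar-multiplier MODEL of (3.52)'s `V′(A)`, block-averaged coarse partner (C3); letters on `(c′, a′)` = sups + ONE fit of `a′`; the rate `(L^k)^{−1∕16}` is part 59's currency artefact.  NE2⁺ NOT
printed ∕ NOT proved; no statement of record touched; N15 NOT discharged; K3⁸ OPEN; counts UNMOVED (typed 28∕28 · discharged 5∕27); one finite torus per index — NOT ℝ⁴ ∕ infinite volume ∕ OS ∕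
mass gap ∕ Clay.
-/

noncomputable section

open scoped BigOperators
open Finset

namespace Summit.QuantumFields.YangMills.BalabanUVNodes.N15.TwoGrid

open Literature.MathematicalPhysics.QuantumFieldTheory.Balaban1983to89
open Literature.MathematicalPhysics.QuantumFieldTheory.Balaban1983to89.B11SectG (BlockNorm HasMaj hasMaj_comp hasMaj_comp_exp RowSum)
open Literature.MathematicalPhysics.QuantumFieldTheory.Balaban1983to89.T4EtaRateDefect (idef idef_apply)
open Literature.MathematicalPhysics.QuantumFieldTheory.Balaban1983to89.T4EtaRateCoeffDefect (pull pull_apply diagK blockAvg hasMaj_idef_mulOp)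
open Literature.MathematicalPhysics.QuantumFieldTheory.Balaban1983to89.B9SectDWeightedNeumann (WRow wrow_of_exp)
open Literature.MathematicalPhysics.QuantumFieldTheory.Balaban1983to89.B6RandomWalk (Triangle254)
open Literature.MathematicalPhysics.QuantumFieldTheory.Balaban1983to89.B6Prop26Gluing (mulOp mulOp_apply)
open Literature.MathematicalPhysics.QuantumFieldTheory.Balaban1983to89.B5Prop11Plancherel (Tor fine unitVec)
open Literature.MathematicalPhysics.QuantumFieldTheory.Balaban1983to89.B5SiteBridgeP12 (MP)
open Literature.MathematicalPhysics.QuantumFieldTheory.Balaban1983to89.B5SettingP12Weighted (etaPow etaPow_nonneg)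
open Literature.MathematicalPhysics.QuantumFieldTheory.King1986.Torus (blockOf tdistT tdistT_nonneg)
open Literature.MathematicalPhysics.QuantumFieldTheory.Balaban1983to89.B6UnitTorusCarrier (unitTorusGeo triangle254_unitTorusGeo rowSum_unitTorusGeo)
open Summit.QuantumFields.YangMills.BalabanUVNodes.N15.VectorPiece (blkFine kingPrV blkFine_comp_kingPrV)
open Summit.QuantumFields.YangMills.BalabanUVNodes.N15.BackgroundModel (kappa_ofBlocks)
open Summit.QuantumFields.YangMills.BalabanUVNodes.N15.BackgroundStep (idef_background_propagator_majorant_flat)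
open Summit.QuantumFields.YangMills.BalabanUVNodes.N15.BackgroundLayer (bgPropV bgPropV_fix isUnit_stepV hasMaj_bgPropV hasMaj_V_bgPropV stack unstack projO liftPair
  blkPair bgPair idef_stack hasMaj_stack hasMaj_unstack hasMaj_projO_comp abs_blockAvg_le)

variable {d : ℕ}

/-! ## §11 III-B with the L²-block norm on the stacked fine carrier as target (torus carriers, rows as hypotheses) -/

section Rows

variable {L : ℕ} [NeZero L] (M : Fin (d + 1) → ℕ) [∀ μ, NeZero (M μ)] (k m : ℕ)

/-- a sup-block front composed with a diagonal coarse-to-fine letter, read into the fine L²-blocks: `≤ √(d+1)·β·o·e^{−δd}`. [folklore] -/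
theorem hasMaj_comp_diagK_const_l2 {T : (Tor (fine (L ^ m * L ^ k) M) × Fin (d + 1) → ℝ) →ₗ[ℝ] (Tor (fine (L ^ m * L ^ k) M) × Fin (d + 1) → ℝ)}
    {V : (Tor (fine (L ^ k) M) × Fin (d + 1) → ℝ) →ₗ[ℝ] (Tor (fine (L ^ m * L ^ k) M) × Fin (d + 1) → ℝ)} {β δ o : ℝ} (hβ : 0 ≤ β)
    (hT : HasMaj (BlockNorm.ofBlocks (unitTorusGeo L k M) (fun i : Tor (fine (L ^ m * L ^ k) M) × Fin (d + 1) => blockOf (L ^ m * L ^ k) M i.1))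
      (BlockNorm.ofBlocks (unitTorusGeo L k M) (fun i : Tor (fine (L ^ m * L ^ k) M) × Fin (d + 1) => blockOf (L ^ m * L ^ k) M i.1)) T (fun y y' => β * Real.exp (-(δ * tdistT M y y'))))
    (hV : HasMaj (BlockNorm.ofBlocks (unitTorusGeo L k M) (blkFine L k M))
      (BlockNorm.ofBlocks (unitTorusGeo L k M) (fun i : Tor (fine (L ^ m * L ^ k) M) × Fin (d + 1) => blockOf (L ^ m * L ^ k) M i.1)) V (diagK fun _ => o)) :
    HasMaj (BlockNorm.ofBlocks (unitTorusGeo L k M) (blkFine L k M))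
      (BlockNorm.l2Blocks (unitTorusGeo L k M) (fun i : Tor (fine (L ^ m * L ^ k) M) × Fin (d + 1) => blockOf (L ^ m * L ^ k) M i.1) (etaPow (L ^ m * L ^ k) (d + 1)) (etaPow_nonneg _ _))
      (T ∘ₗ V) (fun y y' => Real.sqrt ((d : ℝ) + 1) * β * o * Real.exp (-(δ * tdistT M y y'))) := by
  have hT₂ := HasMaj.to_l2Blocks (g := unitTorusGeo L k M) (blk := fun i : Tor (fine (L ^ m * L ^ k) M) × Fin (d + 1) => blockOf (L ^ m * L ^ k) M i.1)
    (w := etaPow (L ^ m * L ^ k) (d + 1)) (etaPow_nonneg _ _) (fun y => (etaPow_mul_card_fineBond M (L ^ m * L ^ k) y).le) hT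
  have key := hasMaj_comp hT₂ hV (fun _ _ => mul_nonneg (Real.sqrt_nonneg _) (mul_nonneg hβ (Real.exp_nonneg _)))
  refine key.mono fun a b => le_of_eq ?_
  rw [kappa_ofBlocks]
  simp only [one_mul, ← mul_assoc]
  rw [sum_mul_diagK_const]
  ring

/-- ★★ **III-B IN (sup → L²-BLOCK) TARGET CURRENCY, ROWS AS HYPOTHESES.**  Torus carriers of the pair of record; pieces `G` (coarse), `G′` (fine), derived pieces `ρ(sD_μ)∘G`, `ρ′(sD′_μ)∘G′`;
sup rows `β·e^{−δd}` on both grids (the jets' Neumann series and the coarse rows), L² rows `β₂·e^{−δd}` of `G′`, `ρ′(sD′_μ)∘G′` (the fine Neumann operator in L²), bare defects and the two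
sandwiched `c′`-rows in (sup → L²) currency (`m_G`, `ζ₀`, `ζ`), the family's sups `≤ r` and ONE fit of `a′` (`o_a`); guards `β·r(d+2)·c_r < 1` (sup), `(d+2)²β₂·r(d+2)·c_r < 1` (L²), `β(1−q)⁻¹ ≤ B_X`.
CONCLUSION: the η-defect of the whole jet through `(pull kingPrV, pull (liftPair kingPrV))` has the (sup → L²-block, stacked) majorant displayed — g0's `idef_background_propagator_majorant_flat` at
`b₂′ :=` the stacked L²-block norm. [cite: Balaban1985BackgroundPropagators, (3.35) p.396, (3.52) p.400, (3.62)–(3.65) pp.402–403 (mechanism); Balaban1984PropagatorsI, Prop. 1.2 (1.114) p.36;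
Balaban1984PropagatorsII, (2.52)–(2.56) pp.232–233, Lemma 2.1 (2.61) p.234] -/
theorem hasMajL2_idef_bgPair_of_rows {σ cr : ℝ} (hσ : 0 ≤ σ) (hcr : 0 ≤ cr) (hrow : RowSum (unitTorusGeo L k M) σ cr)
    {ρ δ β β₂ mG r oa ζ₀ ζ BX : ℝ} (hρ : 0 ≤ ρ) (hρδ : ρ + σ ≤ δ) (hβ : 0 ≤ β) (hβ₂ : 0 ≤ β₂) (hmG : 0 ≤ mG) (hr : 0 ≤ r) (hoa : 0 ≤ oa) (hζ₀ : 0 ≤ ζ₀) (hζ : 0 ≤ ζ)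
    {G : (Tor (fine (L ^ k) M) × Fin (d + 1) → ℝ) →ₗ[ℝ] (Tor (fine (L ^ k) M) × Fin (d + 1) → ℝ)}
    {G' : (Tor (fine (L ^ m * L ^ k) M) × Fin (d + 1) → ℝ) →ₗ[ℝ] (Tor (fine (L ^ m * L ^ k) M) × Fin (d + 1) → ℝ)}
    {c' : Tor (fine (L ^ m * L ^ k) M) × Fin (d + 1) → ℝ} {a' : Fin (d + 1) → Tor (fine (L ^ m * L ^ k) M) × Fin (d + 1) → ℝ}
    (hG : HasMaj (BlockNorm.ofBlocks (unitTorusGeo L k M) (blkFine L k M)) (BlockNorm.ofBlocks (unitTorusGeo L k M) (blkFine L k M)) G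
      (fun y y' => β * Real.exp (-(δ * tdistT M y y'))))
    (hGD : ∀ μ, HasMaj (BlockNorm.ofBlocks (unitTorusGeo L k M) (blkFine L k M)) (BlockNorm.ofBlocks (unitTorusGeo L k M) (blkFine L k M))
      (symbOp M (L ^ k) (sD M (L ^ k) μ ((L ^ k : ℕ) : ℝ)) ∘ₗ G) (fun y y' => β * Real.exp (-(δ * tdistT M y y'))))
    (hG' : HasMaj (BlockNorm.ofBlocks (unitTorusGeo L k M) (fun i : Tor (fine (L ^ m * L ^ k) M) × Fin (d + 1) => blockOf (L ^ m * L ^ k) M i.1))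
      (BlockNorm.ofBlocks (unitTorusGeo L k M) (fun i : Tor (fine (L ^ m * L ^ k) M) × Fin (d + 1) => blockOf (L ^ m * L ^ k) M i.1)) G'
      (fun y y' => β * Real.exp (-(δ * tdistT M y y'))))
    (hG'D : ∀ μ, HasMaj (BlockNorm.ofBlocks (unitTorusGeo L k M) (fun i : Tor (fine (L ^ m * L ^ k) M) × Fin (d + 1) => blockOf (L ^ m * L ^ k) M i.1))
      (BlockNorm.ofBlocks (unitTorusGeo L k M) (fun i : Tor (fine (L ^ m * L ^ k) M) × Fin (d + 1) => blockOf (L ^ m * L ^ k) M i.1))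
      (symbOp M (L ^ m * L ^ k) (sD M (L ^ m * L ^ k) μ ((L ^ m * L ^ k : ℕ) : ℝ)) ∘ₗ G') (fun y y' => β * Real.exp (-(δ * tdistT M y y'))))
    (hG'₂ : HasMaj (BlockNorm.l2Blocks (unitTorusGeo L k M) (fun i : Tor (fine (L ^ m * L ^ k) M) × Fin (d + 1) => blockOf (L ^ m * L ^ k) M i.1) (etaPow (L ^ m * L ^ k) (d + 1)) (etaPow_nonneg _ _))
      (BlockNorm.l2Blocks (unitTorusGeo L k M) (fun i : Tor (fine (L ^ m * L ^ k) M) × Fin (d + 1) => blockOf (L ^ m * L ^ k) M i.1) (etaPow (L ^ m * L ^ k) (d + 1)) (etaPow_nonneg _ _)) G'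
      (fun y y' => β₂ * Real.exp (-(δ * tdistT M y y'))))
    (hG'D₂ : ∀ μ, HasMaj (BlockNorm.l2Blocks (unitTorusGeo L k M) (fun i : Tor (fine (L ^ m * L ^ k) M) × Fin (d + 1) => blockOf (L ^ m * L ^ k) M i.1) (etaPow (L ^ m * L ^ k) (d + 1)) (etaPow_nonneg _ _))
      (BlockNorm.l2Blocks (unitTorusGeo L k M) (fun i : Tor (fine (L ^ m * L ^ k) M) × Fin (d + 1) => blockOf (L ^ m * L ^ k) M i.1) (etaPow (L ^ m * L ^ k) (d + 1)) (etaPow_nonneg _ _))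
      (symbOp M (L ^ m * L ^ k) (sD M (L ^ m * L ^ k) μ ((L ^ m * L ^ k : ℕ) : ℝ)) ∘ₗ G') (fun y y' => β₂ * Real.exp (-(δ * tdistT M y y'))))
    (hDG : HasMaj (BlockNorm.ofBlocks (unitTorusGeo L k M) (blkFine L k M))
      (BlockNorm.l2Blocks (unitTorusGeo L k M) (fun i : Tor (fine (L ^ m * L ^ k) M) × Fin (d + 1) => blockOf (L ^ m * L ^ k) M i.1) (etaPow (L ^ m * L ^ k) (d + 1)) (etaPow_nonneg _ _))
      (idef (pull (kingPrV L k m M)) (pull (kingPrV L k m M)) G' G) (fun y y' => mG * Real.exp (-(δ * tdistT M y y'))))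
    (hDD : ∀ μ, HasMaj (BlockNorm.ofBlocks (unitTorusGeo L k M) (blkFine L k M))
      (BlockNorm.l2Blocks (unitTorusGeo L k M) (fun i : Tor (fine (L ^ m * L ^ k) M) × Fin (d + 1) => blockOf (L ^ m * L ^ k) M i.1) (etaPow (L ^ m * L ^ k) (d + 1)) (etaPow_nonneg _ _))
      (idef (pull (kingPrV L k m M)) (pull (kingPrV L k m M)) (symbOp M (L ^ m * L ^ k) (sD M (L ^ m * L ^ k) μ ((L ^ m * L ^ k : ℕ) : ℝ)) ∘ₗ G')
        (symbOp M (L ^ k) (sD M (L ^ k) μ ((L ^ k : ℕ) : ℝ)) ∘ₗ G)) (fun y y' => mG * Real.exp (-(δ * tdistT M y y'))))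
    (hGc : HasMaj (BlockNorm.ofBlocks (unitTorusGeo L k M) (blkFine L k M))
      (BlockNorm.l2Blocks (unitTorusGeo L k M) (fun i : Tor (fine (L ^ m * L ^ k) M) × Fin (d + 1) => blockOf (L ^ m * L ^ k) M i.1) (etaPow (L ^ m * L ^ k) (d + 1)) (etaPow_nonneg _ _))
      (G' ∘ₗ idef (pull (kingPrV L k m M)) (pull (kingPrV L k m M)) (mulOp c') (mulOp (blockAvg (kingPrV L k m M) c'))) (fun y y' => ζ₀ * Real.exp (-(δ * tdistT M y y'))))
    (hDGc : ∀ ν, HasMaj (BlockNorm.ofBlocks (unitTorusGeo L k M) (blkFine L k M))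
      (BlockNorm.l2Blocks (unitTorusGeo L k M) (fun i : Tor (fine (L ^ m * L ^ k) M) × Fin (d + 1) => blockOf (L ^ m * L ^ k) M i.1) (etaPow (L ^ m * L ^ k) (d + 1)) (etaPow_nonneg _ _))
      ((symbOp M (L ^ m * L ^ k) (sD M (L ^ m * L ^ k) ν ((L ^ m * L ^ k : ℕ) : ℝ)) ∘ₗ G') ∘ₗ
        idef (pull (kingPrV L k m M)) (pull (kingPrV L k m M)) (mulOp c') (mulOp (blockAvg (kingPrV L k m M) c'))) (fun y y' => ζ * Real.exp (-(δ * tdistT M y y'))))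
    (hc' : ∀ z, |c' z| ≤ r) (ha' : ∀ μ z, |a' μ z| ≤ r)
    (hfa : ∀ μ z, |a' μ z - blockAvg (kingPrV L k m M) (a' μ) (kingPrV L k m M z)| ≤ oa)
    (hq : β * (r * (d + 2)) * cr < 1) (hq₂ : ((d : ℝ) + 2) * β₂ * (r * (d + 2)) * cr < 1) (hBX : β * (1 - β * (r * (d + 2)) * cr)⁻¹ ≤ BX) :
    HasMaj (BlockNorm.ofBlocks (unitTorusGeo L k M) (blkFine L k M))
      (BlockNorm.l2Blocks (unitTorusGeo L k M) (blkPair (J := Fin (d + 1)) fun i : Tor (fine (L ^ m * L ^ k) M) × Fin (d + 1) => blockOf (L ^ m * L ^ k) M i.1) (etaPow (L ^ m * L ^ k) (d + 1))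
        (etaPow_nonneg _ _))
      (idef (pull (kingPrV L k m M)) (pull (liftPair (J := Fin (d + 1)) (kingPrV L k m M)))
        (bgPair G' (fun μ => symbOp M (L ^ m * L ^ k) (sD M (L ^ m * L ^ k) μ ((L ^ m * L ^ k : ℕ) : ℝ)) ∘ₗ G') c' a')
        (bgPair G (fun μ => symbOp M (L ^ k) (sD M (L ^ k) μ ((L ^ k : ℕ) : ℝ)) ∘ₗ G) (blockAvg (kingPrV L k m M) c') (fun μ => blockAvg (kingPrV L k m M) (a' μ))))
      (fun y y' =>
        (((d : ℝ) + 2) * mG * cr + 1 * (((d : ℝ) + 2) * mG * cr) * (r * (d + 2) * (β * (1 - β * (r * (d + 2)) * cr)⁻¹)) +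
            ((d : ℝ) + 2) * ((ζ₀ + ζ + ((d : ℝ) + 1) * (Real.sqrt ((d : ℝ) + 1) * β * oa)) * BX * cr)) *
          (1 - 1 * (((d : ℝ) + 2) * β₂ * (r * (d + 2)) * cr))⁻¹ * Real.exp (-(ρ * tdistT M y y'))) := by
  -- geometry and bookkeeping
  have htri : Triangle254 (unitTorusGeo L k M) := triangle254_unitTorusGeo L k M
  have hd : ∀ a b : (unitTorusGeo L k M).Site, 0 ≤ (unitTorusGeo L k M).dist a b := fun a b => tdistT_nonneg M a b
  have hq0 : 0 < 1 - β * (r * (d + 2)) * cr := by linarith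
  set βX : ℝ := β * (1 - β * (r * (d + 2)) * cr)⁻¹ with hβX_def
  have hβX : 0 ≤ βX := mul_nonneg hβ (inv_nonneg.2 hq0.le)
  have hBX0 : 0 ≤ BX := hβX.trans hBX
  have hJ : (1 + (Fintype.card (Fin (d + 1)) : ℝ)) = (d : ℝ) + 2 := by rw [Fintype.card_fin]; push_cast; ring
  have hR : r * (1 + (Fintype.card (Fin (d + 1)) : ℝ)) ≤ r * (d + 2) := by rw [hJ]
  have hRd : (0 : ℝ) ≤ r * (d + 2) := by positivity
  have hsd : 0 ≤ Real.sqrt ((d : ℝ) + 1) := Real.sqrt_nonneg _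
  -- names
  set Dc : Fin (d + 1) → (Tor (fine (L ^ k) M) × Fin (d + 1) → ℝ) →ₗ[ℝ] (Tor (fine (L ^ k) M) × Fin (d + 1) → ℝ) :=
    fun μ => symbOp M (L ^ k) (sD M (L ^ k) μ ((L ^ k : ℕ) : ℝ)) with hDc
  set Df : Fin (d + 1) → (Tor (fine (L ^ m * L ^ k) M) × Fin (d + 1) → ℝ) →ₗ[ℝ] (Tor (fine (L ^ m * L ^ k) M) × Fin (d + 1) → ℝ) :=
    fun μ => symbOp M (L ^ m * L ^ k) (sD M (L ^ m * L ^ k) μ ((L ^ m * L ^ k : ℕ) : ℝ)) with hDf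
  set c : Tor (fine (L ^ k) M) × Fin (d + 1) → ℝ := blockAvg (kingPrV L k m M) c' with hc_def
  set a : Fin (d + 1) → Tor (fine (L ^ k) M) × Fin (d + 1) → ℝ := fun μ => blockAvg (kingPrV L k m M) (a' μ) with ha_def
  have hc : ∀ x, |c x| ≤ r := abs_blockAvg_le (kingPrV L k m M) hr hc'
  have ha : ∀ μ x, |a μ x| ≤ r := fun μ => abs_blockAvg_le (kingPrV L k m M) hr (ha' μ)
  have hblk : blkFine L k M ∘ kingPrV L k m M = fun i : Tor (fine (L ^ m * L ^ k) M) × Fin (d + 1) => blockOf (L ^ m * L ^ k) M i.1 := blkFine_comp_kingPrV M L k m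
  set b₁ := BlockNorm.ofBlocks (unitTorusGeo L k M) (blkFine L k M) with hb₁
  set bf := BlockNorm.ofBlocks (unitTorusGeo L k M) (fun i : Tor (fine (L ^ m * L ^ k) M) × Fin (d + 1) => blockOf (L ^ m * L ^ k) M i.1) with hbf
  set L2f := BlockNorm.l2Blocks (unitTorusGeo L k M) (fun i : Tor (fine (L ^ m * L ^ k) M) × Fin (d + 1) => blockOf (L ^ m * L ^ k) M i.1) (etaPow (L ^ m * L ^ k) (d + 1))
    (etaPow_nonneg _ _) with hL2f
  set L2s := BlockNorm.l2Blocks (unitTorusGeo L k M) (blkPair (J := Fin (d + 1)) fun i : Tor (fine (L ^ m * L ^ k) M) × Fin (d + 1) => blockOf (L ^ m * L ^ k) M i.1) (etaPow (L ^ m * L ^ k) (d + 1))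
    (etaPow_nonneg _ _) with hL2s
  -- (1) the sup-currency stacked layers: the jets exist, the coarse jet and its components
  have hβe : ∀ y y' : Tor M, 0 ≤ β * Real.exp (-(δ * tdistT M y y')) := fun _ _ => mul_nonneg hβ (Real.exp_nonneg _)
  have hSG : HasMaj b₁ (BlockNorm.ofBlocks (unitTorusGeo L k M) (blkPair (blkFine L k M))) (stack G (fun μ => Dc μ ∘ₗ G)) (fun y y' => β * Real.exp (-(δ * tdistT M y y'))) :=
    hasMaj_stack (g := unitTorusGeo L k M) (blkFine L k M) hβe hG hGD
  have hSG' : HasMaj bf (BlockNorm.ofBlocks (unitTorusGeo L k M) (blkPair (J := Fin (d + 1)) fun i : Tor (fine (L ^ m * L ^ k) M) × Fin (d + 1) => blockOf (L ^ m * L ^ k) M i.1))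
      (stack G' (fun μ => Df μ ∘ₗ G')) (fun y y' => β * Real.exp (-(δ * tdistT M y y'))) :=
    hasMaj_stack (g := unitTorusGeo L k M) _ hβe hG' hG'D
  have hV := (hasMaj_unstack (g := unitTorusGeo L k M) (blkFine L k M) hr hc ha).mono fun y y' => diagK_const_mono hR y y'
  have hV' := (hasMaj_unstack (g := unitTorusGeo L k M) (fun i : Tor (fine (L ^ m * L ^ k) M) × Fin (d + 1) => blockOf (L ^ m * L ^ k) M i.1) hr hc' ha').mono
    fun y y' => diagK_const_mono hR y y'
  have hfix := bgPropV_fix (isUnit_stepV (blkFine L k M) (blkPair (blkFine L k M)) hd hrow (by linarith) hβ hRd hSG hV hq)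
  have hfix' := bgPropV_fix (isUnit_stepV (fun i : Tor (fine (L ^ m * L ^ k) M) × Fin (d + 1) => blockOf (L ^ m * L ^ k) M i.1)
    (blkPair (J := Fin (d + 1)) fun i : Tor (fine (L ^ m * L ^ k) M) × Fin (d + 1) => blockOf (L ^ m * L ^ k) M i.1) hd hrow (by linarith) hβ hRd hSG' hV' hq)
  have hX := hasMaj_bgPropV (g := unitTorusGeo L k M) (blkFine L k M) (blkPair (blkFine L k M)) htri hd hrow hσ hρ hρδ hβ hRd hSG hV hq
  have hXv : HasMaj b₁ b₁ (projO none ∘ₗ bgPair G (fun μ => Dc μ ∘ₗ G) c a) (fun y y' => βX * Real.exp (-(ρ * tdistT M y y'))) :=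
    hasMaj_projO_comp (g := unitTorusGeo L k M) (blkFine L k M) hX none
  have hYb : ∀ μ, HasMaj b₁ b₁ (projO (some μ) ∘ₗ bgPair G (fun μ => Dc μ ∘ₗ G) c a) (fun y y' => βX * Real.exp (-(ρ * tdistT M y y'))) := fun μ =>
    hasMaj_projO_comp (g := unitTorusGeo L k M) (blkFine L k M) hX (some μ)
  have hVX := hasMaj_V_bgPropV (g := unitTorusGeo L k M) (blkFine L k M) (blkPair (blkFine L k M)) htri hd hrow hσ hρ hρδ hβ hRd hSG hV hq
  -- (2) the fine Neumann operator `K′ = stack G′ D′ ∘ unstack c′ a′` in L²-block currency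
  have hβ₂e : ∀ y y' : Tor M, 0 ≤ β₂ * Real.exp (-(δ * tdistT M y y')) := fun _ _ => mul_nonneg hβ₂ (Real.exp_nonneg _)
  have hSG'₂ : HasMaj L2f L2s (stack G' (fun μ => Df μ ∘ₗ G')) (fun y y' => (1 + (Fintype.card (Fin (d + 1)) : ℝ)) * (β₂ * Real.exp (-(δ * tdistT M y y')))) :=
    hasMaj_stack_l2 (g := unitTorusGeo L k M) (etaPow_nonneg _ _) hβ₂e hG'₂ hG'D₂
  have hV'₂ := (hasMaj_unstack_l2 (g := unitTorusGeo L k M) (blk := fun i : Tor (fine (L ^ m * L ^ k) M) × Fin (d + 1) => blockOf (L ^ m * L ^ k) M i.1)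
    (w := etaPow (L ^ m * L ^ k) (d + 1)) (J := Fin (d + 1)) (etaPow_nonneg _ _) hr hc' ha').mono fun y y' => diagK_const_mono hR y y'
  have hK' : HasMaj L2s L2s (stack G' (fun μ => Df μ ∘ₗ G') ∘ₗ unstack c' a') (fun y y' => ((d : ℝ) + 2) * β₂ * (r * (d + 2)) * Real.exp (-(δ * tdistT M y y'))) := by
    have key := hasMaj_comp hSG'₂ hV'₂ (fun _ _ => mul_nonneg (by positivity) (mul_nonneg hβ₂ (Real.exp_nonneg _)))
    refine key.mono fun y y' => le_of_eq ?_
    rw [κ_l2Blocks]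
    simp only [one_mul, ← mul_assoc]
    rw [sum_mul_diagK_const, hJ]
    ring
  have hm' : WRow (unitTorusGeo L k M) ρ (fun y y' => ((d : ℝ) + 2) * β₂ * (r * (d + 2)) * Real.exp (-(δ * tdistT M y y'))) (((d : ℝ) + 2) * β₂ * (r * (d + 2)) * cr) :=
    wrow_of_exp hd hrow (by positivity) hρδ
  -- (3) the stacked bare defect in (sup → L²) currency
  have hme : ∀ y y' : Tor M, 0 ≤ mG * Real.exp (-(δ * tdistT M y y')) := fun _ _ => mul_nonneg hmG (Real.exp_nonneg _)
  have hSD : HasMaj b₁ L2s (idef (pull (kingPrV L k m M)) (pull (liftPair (J := Fin (d + 1)) (kingPrV L k m M))) (stack G' (fun μ => Df μ ∘ₗ G')) (stack G (fun μ => Dc μ ∘ₗ G)))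
      (fun y y' => ((d : ℝ) + 2) * mG * Real.exp (-(δ * tdistT M y y'))) := by
    rw [idef_stack]
    refine (hasMaj_stack_l2 (g := unitTorusGeo L k M) (etaPow_nonneg _ _) hme hDG hDD).mono fun y y' => le_of_eq ?_
    rw [hJ]; ring
  have hmGw : WRow (unitTorusGeo L k M) ρ (fun y y' => ((d : ℝ) + 2) * mG * Real.exp (-(δ * tdistT M y y'))) (((d : ℝ) + 2) * mG * cr) :=
    wrow_of_exp hd hrow (by positivity) hρδ
  -- (4) the sandwiched coefficient defect, L² target: the `c′`-rows + the diagonal `a′`-fit rows, composed with the coarse jet, stacked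
  have hfit : ∀ μ, HasMaj b₁ bf (idef (pull (kingPrV L k m M)) (pull (kingPrV L k m M)) (mulOp (a' μ)) (mulOp (a μ))) (diagK fun _ => oa) := by
    intro μ
    have h := hasMaj_idef_mulOp (g := unitTorusGeo L k M) (blkFine L k M) (kingPrV L k m M) (a' := a' μ) (a := a μ) (o := fun _ => oa) (fun _ => hoa) fun z => hfa μ z
    rw [hblk] at h
    exact h
  have haG : ∀ μ, HasMaj b₁ L2f (G' ∘ₗ idef (pull (kingPrV L k m M)) (pull (kingPrV L k m M)) (mulOp (a' μ)) (mulOp (a μ)))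
      (fun y y' => Real.sqrt ((d : ℝ) + 1) * β * oa * Real.exp (-(δ * tdistT M y y'))) := fun μ => hasMaj_comp_diagK_const_l2 M k m hβ hG' (hfit μ)
  have haD : ∀ ν μ, HasMaj b₁ L2f ((Df ν ∘ₗ G') ∘ₗ idef (pull (kingPrV L k m M)) (pull (kingPrV L k m M)) (mulOp (a' μ)) (mulOp (a μ)))
      (fun y y' => Real.sqrt ((d : ℝ) + 1) * β * oa * Real.exp (-(δ * tdistT M y y'))) := fun ν μ => hasMaj_comp_diagK_const_l2 M k m hβ (hG'D ν) (hfit μ)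
  set W := idef (pull (kingPrV L k m M)) (pull (kingPrV L k m M)) (mulOp c') (mulOp c) ∘ₗ (projO none ∘ₗ bgPair G (fun μ => Dc μ ∘ₗ G) c a) +
      ∑ μ, idef (pull (kingPrV L k m M)) (pull (kingPrV L k m M)) (mulOp (a' μ)) (mulOp (a μ)) ∘ₗ (projO (some μ) ∘ₗ bgPair G (fun μ => Dc μ ∘ₗ G) c a) with hW_def
  have hfront : ∀ {Tf : (Tor (fine (L ^ m * L ^ k) M) × Fin (d + 1) → ℝ) →ₗ[ℝ] (Tor (fine (L ^ m * L ^ k) M) × Fin (d + 1) → ℝ)} {ζf : ℝ}, 0 ≤ ζf →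
      HasMaj b₁ L2f (Tf ∘ₗ idef (pull (kingPrV L k m M)) (pull (kingPrV L k m M)) (mulOp c') (mulOp c)) (fun y y' => ζf * Real.exp (-(δ * tdistT M y y'))) →
      (∀ μ, HasMaj b₁ L2f (Tf ∘ₗ idef (pull (kingPrV L k m M)) (pull (kingPrV L k m M)) (mulOp (a' μ)) (mulOp (a μ)))
        (fun y y' => Real.sqrt ((d : ℝ) + 1) * β * oa * Real.exp (-(δ * tdistT M y y')))) →
      HasMaj b₁ L2f (Tf ∘ₗ W) (fun y y' => (ζf + ((d : ℝ) + 1) * (Real.sqrt ((d : ℝ) + 1) * β * oa)) * βX * cr * Real.exp (-(ρ * tdistT M y y'))) := by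
    intro Tf ζf hζf hTc haT
    have e1 := hasMaj_comp_exp (b₁ := b₁) (b₂ := b₁) (b₃ := L2f) htri hd hrow hζf hβX hρ le_rfl hρδ hTc hXv
    have e2 := hasMaj_finsum (b₁ := b₁) (b₂ := L2f) Finset.univ
      (fun μ => (Tf ∘ₗ idef (pull (kingPrV L k m M)) (pull (kingPrV L k m M)) (mulOp (a' μ)) (mulOp (a μ))) ∘ₗ (projO (some μ) ∘ₗ bgPair G (fun μ => Dc μ ∘ₗ G) c a))
      (fun _ y y' => b₁.κ * (Real.sqrt ((d : ℝ) + 1) * β * oa) * βX * cr * Real.exp (-(ρ * tdistT M y y')))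
      fun μ _ => hasMaj_comp_exp (b₁ := b₁) (b₂ := b₁) (b₃ := L2f) htri hd hrow (by positivity) hβX hρ le_rfl hρδ (haT μ) (hYb μ)
    have hop : Tf ∘ₗ W = (Tf ∘ₗ idef (pull (kingPrV L k m M)) (pull (kingPrV L k m M)) (mulOp c') (mulOp c)) ∘ₗ (projO none ∘ₗ bgPair G (fun μ => Dc μ ∘ₗ G) c a) +
        ∑ μ, (Tf ∘ₗ idef (pull (kingPrV L k m M)) (pull (kingPrV L k m M)) (mulOp (a' μ)) (mulOp (a μ))) ∘ₗ (projO (some μ) ∘ₗ bgPair G (fun μ => Dc μ ∘ₗ G) c a) := by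
      rw [hW_def]
      refine LinearMap.ext fun f => ?_
      simp only [LinearMap.comp_apply, LinearMap.add_apply, LinearMap.sum_apply, map_add, map_sum]
    rw [hop]
    refine (e1.add e2).mono fun y y' => le_of_eq ?_
    rw [sum_const, card_univ, Fintype.card_fin, nsmul_eq_mul, hb₁, kappa_ofBlocks]
    push_cast
    ring
  have hWG := hfront hζ₀ hGc haG
  have hWD := fun ν => hfront hζ (hDGc ν) (haD ν)
  -- common constant and the stack
  set CF : ℝ := (ζ₀ + ζ + ((d : ℝ) + 1) * (Real.sqrt ((d : ℝ) + 1) * β * oa)) * BX * cr with hCF_def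
  have hCF : 0 ≤ CF := by positivity
  have hmono : ∀ {T : (Tor (fine (L ^ k) M) × Fin (d + 1) → ℝ) →ₗ[ℝ] (Tor (fine (L ^ m * L ^ k) M) × Fin (d + 1) → ℝ)} {ζf : ℝ}, 0 ≤ ζf → ζf ≤ ζ₀ + ζ →
      HasMaj b₁ L2f T (fun y y' => (ζf + ((d : ℝ) + 1) * (Real.sqrt ((d : ℝ) + 1) * β * oa)) * βX * cr * Real.exp (-(ρ * tdistT M y y'))) →
      HasMaj b₁ L2f T (fun y y' => CF * Real.exp (-(ρ * tdistT M y y'))) := by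
    intro T ζf hζf hle h
    refine h.mono fun y y' => mul_le_mul_of_nonneg_right ?_ (Real.exp_nonneg _)
    rw [hCF_def]
    have h1 : ζf + ((d : ℝ) + 1) * (Real.sqrt ((d : ℝ) + 1) * β * oa) ≤ ζ₀ + ζ + ((d : ℝ) + 1) * (Real.sqrt ((d : ℝ) + 1) * β * oa) := by linarith
    have h0 : 0 ≤ ζf + ((d : ℝ) + 1) * (Real.sqrt ((d : ℝ) + 1) * β * oa) := by positivity
    calc (ζf + ((d : ℝ) + 1) * (Real.sqrt ((d : ℝ) + 1) * β * oa)) * βX * cr ≤ (ζ₀ + ζ + ((d : ℝ) + 1) * (Real.sqrt ((d : ℝ) + 1) * β * oa)) * βX * cr :=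
          mul_le_mul_of_nonneg_right (mul_le_mul_of_nonneg_right h1 hβX) hcr
      _ ≤ (ζ₀ + ζ + ((d : ℝ) + 1) * (Real.sqrt ((d : ℝ) + 1) * β * oa)) * BX * cr :=
          mul_le_mul_of_nonneg_right (mul_le_mul_of_nonneg_left hBX (by positivity)) hcr
  have hWG' := hmono hζ₀ (le_add_of_nonneg_right hζ) hWG
  have hWD' := fun ν => hmono hζ (le_add_of_nonneg_left hζ₀) (hWD ν)
  have hW : idef (pull (liftPair (J := Fin (d + 1)) (kingPrV L k m M))) (pull (kingPrV L k m M)) (unstack c' a') (unstack c a) ∘ₗ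
      bgPropV (stack G (fun μ => Dc μ ∘ₗ G)) (unstack c a) = W := by
    rw [hW_def, idef_unstack_eq]
    refine LinearMap.ext fun f => ?_
    simp only [LinearMap.comp_apply, LinearMap.add_apply, LinearMap.sum_apply, bgPair]
  have hst : stack G' (fun μ => Df μ ∘ₗ G') ∘ₗ idef (pull (liftPair (J := Fin (d + 1)) (kingPrV L k m M))) (pull (kingPrV L k m M)) (unstack c' a') (unstack c a) ∘ₗ
      bgPropV (stack G (fun μ => Dc μ ∘ₗ G)) (unstack c a) = stack (G' ∘ₗ W) (fun ν => (Df ν ∘ₗ G') ∘ₗ W) := by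
    rw [hW, stack_comp]
  have hDVs : HasMaj b₁ L2s (stack G' (fun μ => Df μ ∘ₗ G') ∘ₗ idef (pull (liftPair (J := Fin (d + 1)) (kingPrV L k m M))) (pull (kingPrV L k m M)) (unstack c' a') (unstack c a) ∘ₗ
        bgPropV (stack G (fun μ => Dc μ ∘ₗ G)) (unstack c a))
      (fun y y' => ((d : ℝ) + 2) * CF * Real.exp (-(ρ * tdistT M y y'))) := by
    rw [hst]
    refine (hasMaj_stack_l2 (g := unitTorusGeo L k M) (etaPow_nonneg _ _) (fun _ _ => mul_nonneg hCF (Real.exp_nonneg _)) hWG' hWD').mono fun y y' => le_of_eq ?_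
    rw [hJ]; ring
  -- (5) a priori
  obtain ⟨M₀, hM₀, hap⟩ := exists_const_hasMaj_l2 (g := unitTorusGeo L k M) (blk := blkPair (J := Fin (d + 1)) fun i : Tor (fine (L ^ m * L ^ k) M) × Fin (d + 1) => blockOf (L ^ m * L ^ k) M i.1)
    (w := etaPow (L ^ m * L ^ k) (d + 1)) (etaPow_nonneg _ _) (blkFine L k M)
    (idef (pull (kingPrV L k m M)) (pull (liftPair (J := Fin (d + 1)) (kingPrV L k m M))) (bgPropV (stack G' (fun μ => Df μ ∘ₗ G')) (unstack c' a'))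
      (bgPropV (stack G (fun μ => Dc μ ∘ₗ G)) (unstack c a)))
  -- (6) g0's device with the L² target
  have hq₂' : L2s.κ * (((d : ℝ) + 2) * β₂ * (r * (d + 2)) * cr) < 1 := by rw [hL2s, κ_l2Blocks, one_mul]; exact hq₂
  have key := idef_background_propagator_majorant_flat (b₁ := b₁) (b₂' := L2s) (τ₁ := pull (kingPrV L k m M)) (τ₂ := pull (liftPair (J := Fin (d + 1)) (kingPrV L k m M)))
    (G₁ := stack G (fun μ => Dc μ ∘ₗ G)) (Xc := bgPropV (stack G (fun μ => Dc μ ∘ₗ G)) (unstack c a)) (V := unstack c a)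
    (G₁' := stack G' (fun μ => Df μ ∘ₗ G')) (Xf := bgPropV (stack G' (fun μ => Df μ ∘ₗ G')) (unstack c' a')) (V' := unstack c' a') (ρ := ρ) htri hd hρ
    (mul_nonneg hRd hβX) (by positivity : 0 ≤ ((d : ℝ) + 2) * CF) hM₀
    (fun _ _ => mul_nonneg (by positivity) (Real.exp_nonneg _)) hm' (fun _ _ => mul_nonneg (by positivity) (Real.exp_nonneg _)) hmGw
    hfix hfix' hK' hVX hSD hDVs hap hq₂'
  refine key.mono fun y y' => le_of_eq ?_
  rw [hb₁, hL2s, kappa_ofBlocks, κ_l2Blocks, hCF_def]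

end Rows

end Summit.QuantumFields.YangMills.BalabanUVNodes.N15.TwoGrid

end
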